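import Summits.KontsevichZagierPeriods.KontsevichZagierPeriods.Theorems.HermiteRigidityReductionRigidityDehnClosedReduces
import Summits.KontsevichZagierPeriods.KontsevichZagierPeriods.Theorems.HermiteRigidityReductionRigidityBoxTriangleBridgeNeg

/-!
# `ReductionRigidity` (stmt-KontsevichZagierPeriods-3407), line `Sketch`, growth line
# `bloch-suslin-rational-dilog`: the real five-term transfer in TRIANGLE syntax
# (`stub_triangleNeumannTransfer`)

Route `KontsevichZagierPeriods/HermiteRigidity`, crux `ReductionRigidity` (stmt-3407), registered
wave-2 sub-goal stub `stub_triangleNeumannTransfer`: the landed REAL FIVE-TERM TRANSFER at rational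
arguments (`stub_neumannTransfer`, `…NeumannTransfer.lean`, written in this crux's BOX syntax
`[□², z/(1 − z p₀ p₁)]` for the dilogarithm symbols) restated in the TRIANGLE (iterated-integral)
syntax of the crux `OffTetraSectorKernel` (stmt-10557):

  `Li₂(z)   = [{0 < v < u < z}, 1/(u(1 − v))]`   (`0 < z < 1`, family `τ`),
  `−Li₂(−y) = [{0 < v < u < y}, 1/(u(1 + v))]`   (`0 < y`, family `μ`).

For ANY two such families the realisation
`B_T(g) = −[μ (−g)]` (`g < 0`), `[τ g]` (`0 < g < 1`), `−[τ g⁻¹]` (`g > 1`) of Neumann's generators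
sends the subgroup generated by ALL rational five-term relators into
`KZ.relations ⊔ ⟨[□², e/((α+βp)(γ+δq))], [□², e/(1+pq)]⟩` (products of two logarithms and the
`ζ(2)`-line): Rogers' carriers modulo functional equations, by moves of the calculus.

Proof: a COROLLARY of the box transfer via the two box–triangle bridges. Choose a box family `ρ`
(`triTransfer_exists_boxFamily`, from the landed `exists_dilogRep` of `…DehnClosedReduces.lean`: the
regular rational representation `z/(1 − z X₀X₁)` on the closed square). Generator by generator
`B_T(g) − B(g) ∈ KZ.relations`
(`triTransfer_gen_sub_mem`): for `g < 0` this is `stub_boxTriangleBridgeNeg` at `a = −g`, for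
`0 < g < 1` it is `stub_boxTriangleBridge` at `a = g`, for `g > 1` both realisations are minus the
`(0,1)`-case at `g⁻¹`. Hence the two lifts differ by an element of `KZ.relations` on the whole free
abelian group (`triTransfer_lift_sub_mem`, induction on `FreeAbelianGroup`), and `stub_neumannTransfer`
concludes.

References: W. D. Neumann, Geom. Topol. Monogr. 1 (1998), eq. (2.3) [cite: Neumann1998, eq. (2.3)];
D. Zagier, *The dilogarithm function* (2007), Ch. I §2 [cite: Zagier2007Dilogarithm, Ch. I §2];
M. Kontsevich, D. Zagier, *Periods* (2001), §1.2 [cite: KontsevichZagier2001, §1.2]. No definitions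
are introduced.
-/

noncomputable section

open MeasureTheory Set

namespace Summit.KontsevichZagierPeriods.HermiteRigidity.ReductionRigidity

open Literature.NumberTheory.Transcendental
open Literature.NumberTheory.Transcendental.KZ

/-! ## A box family of the rational dilogarithm symbols -/

/-- A box FAMILY `ρ` of the rational dilogarithm symbols: `(ρ z)` has domain `□²` and integrand
`z/(1 − z p₀ p₁)` on it for every rational `z < 1` (pointwise: the landed `exists_dilogRep`).
[cite: KontsevichZagier2001, §1.1] -/
theorem triTransfer_exists_boxFamily : ∃ ρ : ℚ → IntegralRep 2, ∀ z : ℚ, z < 1 → z ≠ 0 →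
    (ρ z).domain = cube 2 ∧
      EqOn (ρ z).integrand (fun p => (z : ℝ) / (1 - (z : ℝ) * p 0 * p 1)) (cube 2) := by
  have h : ∀ z : ℚ, ∃ r : IntegralRep 2, z < 1 → r.domain = cube 2 ∧
      EqOn r.integrand (fun p => (z : ℝ) / (1 - (z : ℝ) * p 0 * p 1)) (cube 2) := by
    intro z
    by_cases hz : z < 1
    · obtain ⟨r, hr, hri⟩ := exists_dilogRep z hz
      exact ⟨r, fun _ => ⟨hr, hri⟩⟩
    · obtain ⟨r, -, -⟩ := exists_dilogRep 0 one_pos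
      exact ⟨r, fun h' => absurd h' hz⟩
  choose ρ hρ using h
  exact ⟨ρ, fun z hz _ => hρ z hz⟩

/-! ## Generatorwise comparison of the triangle and box realisations -/

section Compare

variable (τ μ ρ : ℚ → IntegralRep 2)
  (hτ : ∀ z : ℚ, 0 < z → z < 1 → (τ z).domain = {w | 0 < w 1 ∧ w 1 < w 0 ∧ w 0 < (z : ℝ)} ∧
    EqOn (τ z).integrand (fun w => 1 / (w 0 * (1 - w 1))) {w | 0 < w 1 ∧ w 1 < w 0 ∧ w 0 < (z : ℝ)})
  (hμ : ∀ z : ℚ, 0 < z → (μ z).domain = {w | 0 < w 1 ∧ w 1 < w 0 ∧ w 0 < (z : ℝ)} ∧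
    EqOn (μ z).integrand (fun w => 1 / (w 0 * (1 + w 1))) {w | 0 < w 1 ∧ w 1 < w 0 ∧ w 0 < (z : ℝ)})
  (hρ : ∀ z : ℚ, z < 1 → z ≠ 0 → (ρ z).domain = cube 2 ∧
    EqOn (ρ z).integrand (fun p => (z : ℝ) / (1 - (z : ℝ) * p 0 * p 1)) (cube 2))

include hτ hρ in
/-- The `(0,1)` case: `[ρ z] − [τ z] ∈ KZ.relations` is the landed box–triangle bridge at the real
algebraic point `a = z`. [cite: KontsevichZagier2001, §1.2] -/
theorem triTransfer_mid_sub_mem (z : ℚ) (hz0 : 0 < z) (hz1 : z < 1) :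
    KZ.of (ρ z) - KZ.of (τ z) ∈ KZ.relations :=
  stub_boxTriangleBridge (z : ℝ) (isAlgebraic_rat ℚ z) (by exact_mod_cast hz0)
    (by exact_mod_cast hz1.le) (ρ z) (τ z) (hρ z hz1 hz0.ne').1
    ((hρ z hz1 hz0.ne').2.mono inter_subset_left) (hτ z hz0 hz1).1 (hτ z hz0 hz1).2

include hμ hρ in
/-- The negative case: `[ρ z] + [μ (−z)] ∈ KZ.relations` is the negative-argument box–triangle bridge
at the real algebraic point `a = −z` (`z/(1 − z p q) = −a/(1 + a p q)`).
[cite: KontsevichZagier2001, §1.2] -/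
theorem triTransfer_neg_add_mem (z : ℚ) (hz : z < 0) :
    KZ.of (ρ z) + KZ.of (μ (-z)) ∈ KZ.relations := by
  have hz' : 0 < -z := neg_pos.2 hz
  have hρz := hρ z (hz.trans one_pos) hz.ne
  refine stub_boxTriangleBridgeNeg ((-z : ℚ) : ℝ) (isAlgebraic_rat ℚ (-z)) (by exact_mod_cast hz')
    (ρ z) (μ (-z)) hρz.1 (fun p hp => ?_) (hμ (-z) hz').1 (hμ (-z) hz').2
  rw [hρz.2 hp]
  push_cast
  ring

include hτ hμ hρ in
/-- **Generatorwise comparison**: the triangle realisation `B_T` and the box realisation `B` of a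
Neumann generator differ by an element of `KZ.relations` (three cases `g < 0`, `0 < g < 1`,
`g > 1`). [cite: KontsevichZagier2001, §1.2] -/
theorem triTransfer_gen_sub_mem (g : PreBloch.Gen ℚ) :
    (if g.val < 0 then -KZ.of (μ (-g.val)) else if g.val < 1 then KZ.of (τ g.val)
        else -KZ.of (τ g.val⁻¹)) -
      (if g.val < 1 then KZ.of (ρ g.val) else -KZ.of (ρ g.val⁻¹)) ∈ KZ.relations := by
  rcases lt_trichotomy g.val 0 with hz | hz | hz
  · rw [if_pos hz, if_pos (hz.trans one_pos)]
    have : -KZ.of (μ (-g.val)) - KZ.of (ρ g.val) = -(KZ.of (ρ g.val) + KZ.of (μ (-g.val))) := by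
      abel
    rw [this]
    exact KZ.relations.neg_mem (triTransfer_neg_add_mem μ ρ hμ hρ g.val hz)
  · exact absurd hz g.val_ne_zero
  · rcases lt_or_ge g.val 1 with h1 | h1
    · rw [if_neg (not_lt.2 hz.le), if_pos h1, if_pos h1]
      have : KZ.of (τ g.val) - KZ.of (ρ g.val) = -(KZ.of (ρ g.val) - KZ.of (τ g.val)) := by abel
      rw [this]
      exact KZ.relations.neg_mem (triTransfer_mid_sub_mem τ ρ hτ hρ g.val hz h1)
    · have h1' : 1 < g.val := lt_of_le_of_ne h1 (Ne.symm g.val_ne_one)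
      rw [if_neg (not_lt.2 hz.le), if_neg (not_lt.2 h1), if_neg (not_lt.2 h1)]
      have : -KZ.of (τ g.val⁻¹) - -KZ.of (ρ g.val⁻¹) = KZ.of (ρ g.val⁻¹) - KZ.of (τ g.val⁻¹) := by
        abel
      rw [this]
      exact triTransfer_mid_sub_mem τ ρ hτ hρ _ (inv_pos.2 (one_pos.trans h1'))
        (inv_lt_one_of_one_lt₀ h1')

include hτ hμ hρ in
/-- The two lifts differ by an element of `KZ.relations` on the whole free abelian group.
[cite: Neumann1998, eq. (2.3)] -/
theorem triTransfer_lift_sub_mem (ξ : FreeAbelianGroup (PreBloch.Gen ℚ)) :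
    FreeAbelianGroup.lift (fun g : PreBloch.Gen ℚ =>
        if g.val < 0 then -KZ.of (μ (-g.val)) else if g.val < 1 then KZ.of (τ g.val)
          else -KZ.of (τ g.val⁻¹)) ξ -
      FreeAbelianGroup.lift (fun g : PreBloch.Gen ℚ =>
        if g.val < 1 then KZ.of (ρ g.val) else -KZ.of (ρ g.val⁻¹)) ξ ∈ KZ.relations := by
  induction ξ using FreeAbelianGroup.induction_on with
  | zero =>
    rw [map_zero, map_zero, sub_zero]
    exact KZ.relations.zero_mem
  | of g =>
    rw [FreeAbelianGroup.lift_apply_of, FreeAbelianGroup.lift_apply_of]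
    exact triTransfer_gen_sub_mem τ μ ρ hτ hμ hρ g
  | neg g hg =>
    rw [map_neg, map_neg, ← neg_sub']
    exact KZ.relations.neg_mem hg
  | add x y hx hy =>
    rw [map_add, map_add, add_sub_add_comm]
    exact KZ.relations.add_mem hx hy

end Compare

/-! ## The stub -/

/-- **Registered stub `stub_triangleNeumannTransfer` — THE REAL FIVE-TERM TRANSFER IN TRIANGLE SYNTAX**
(wave 2 of the growth line `bloch-suslin-rational-dilog` of crux `ReductionRigidity`,
stmt-KontsevichZagierPeriods-3407; for the named remainder "Rogers carriers modulo functional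
equations" of crux `OffTetraSectorKernel`, stmt-10557): for ANY families `τ`, `μ` of triangle
representations `[{0 < v < u < z}, 1/(u(1 − v))]` (`0 < z < 1`, value `Li₂(z)`) and
`[{0 < v < u < y}, 1/(u(1 + v))]` (`0 < y`, value `−Li₂(−y)`), the realisation
`g ↦ −[μ (−g)]` (`g < 0`), `[τ g]` (`0 < g < 1`), `−[τ g⁻¹]` (`g > 1`) of Neumann's generators sends
the subgroup generated by ALL rational five-term relators
`[x] − [y] + [y/x] − [(1−x⁻¹)/(1−y⁻¹)] + [(1−x)/(1−y)]` into
`KZ.relations ⊔ ⟨[□², e/((α+βp)(γ+δq))], [□², e/(1+pq)]⟩`. Corollary of the box transfer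
`stub_neumannTransfer` through the two box–triangle bridges (`stub_boxTriangleBridge`,
`stub_boxTriangleBridgeNeg`), generator by generator.
[cite: Neumann1998, eq. (2.3)] [cite: Zagier2007Dilogarithm, Ch. I §2]
[cite: KontsevichZagier2001, §1.2] -/
theorem stub_triangleNeumannTransfer : ∀ (τ μ : ℚ → IntegralRep 2),
    (∀ z : ℚ, 0 < z → z < 1 → (τ z).domain = {w | 0 < w 1 ∧ w 1 < w 0 ∧ w 0 < (z : ℝ)} ∧
      EqOn (τ z).integrand (fun w => 1 / (w 0 * (1 - w 1))) {w | 0 < w 1 ∧ w 1 < w 0 ∧ w 0 < (z : ℝ)}) →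
    (∀ z : ℚ, 0 < z → (μ z).domain = {w | 0 < w 1 ∧ w 1 < w 0 ∧ w 0 < (z : ℝ)} ∧
      EqOn (μ z).integrand (fun w => 1 / (w 0 * (1 + w 1))) {w | 0 < w 1 ∧ w 1 < w 0 ∧ w 0 < (z : ℝ)}) →
    ∀ ξ ∈ AddSubgroup.closure (fiveTermRelators ℚ),
      FreeAbelianGroup.lift (fun g : PreBloch.Gen ℚ =>
          if g.val < 0 then -KZ.of (μ (-g.val)) else if g.val < 1 then KZ.of (τ g.val) else -KZ.of (τ g.val⁻¹)) ξ ∈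
        KZ.relations ⊔ AddSubgroup.closure
          ({c | ∃ (r : IntegralRep 2) (e α β γ δ : ℚ), 0 < α ∧ 0 < α + β ∧ 0 < γ ∧ 0 < γ + δ ∧
              r.domain = cube 2 ∧
              EqOn r.integrand (fun p => (e : ℝ) / (((α : ℝ) + β * p 0) * ((γ : ℝ) + δ * p 1))) (cube 2) ∧
              c = KZ.of r} ∪
            {c | ∃ (r : IntegralRep 2) (e : ℚ), r.domain = cube 2 ∧
              EqOn r.integrand (fun p => (e : ℝ) / (1 + p 0 * p 1)) (cube 2) ∧ c = KZ.of r}) := by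
  intro τ μ hτ hμ ξ hξ
  -- a box family of the rational symbols and the box transfer for it
  obtain ⟨ρ, hρ⟩ := triTransfer_exists_boxFamily
  have hB := stub_neumannTransfer ρ hρ ξ hξ
  -- the two lifts differ by a relation
  have hD := triTransfer_lift_sub_mem τ μ ρ hτ hμ hρ ξ
  have h := AddSubgroup.add_mem _ (AddSubgroup.mem_sup_left hD) hB
  rwa [sub_add_cancel] at h

end Summit.KontsevichZagierPeriods.HermiteRigidity.ReductionRigidity

end
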